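import Literature.Computability.MetaComplexity.EFModMulUShiftMul
import HarnessLib

/-!
# Commutativity of uniform modular multiplication, part A: the kit

Layer E/6 (uniform variant). The commutativity KIT `ModMulU.Comm.commT L` on the inputs
`a, b, n, z` (`3L + 1`; `z` the zero gate): the comparators `(a, n)` and `(b, n)`, the shift
chains of `b` and of `a` (`ModMulU.One.oneT`), the certified multipliers `M_s = a ⊗ B_s`
(`B_s = b >> (L - s)`, `s ≤ L`; `M_L = a ⊗ b`), per stage `s < L` the distributivity kits
`LD1_s = LD(B_s, B_s, a)` and `LD2_s = LD(R(B_s ⊕ B_s), u_s, a)` (`u_s = (b_{L-1-s}, z, …, z)`),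
and the certified multiplier `BA = b ⊗ a`. Part B proves `a ⊗ B_s ≡ B_s ⊗ a` by induction on
`s` and concludes `a ⊗ b ≡ b ⊗ a`.

This part: the layout, its offsets and well-formedness.

## Sources

* H. Vollmer, *Introduction to Circuit Complexity* (Springer 1999), §1.2–1.3.
* J. Krajíček, *Bounded Arithmetic, Propositional Logic, and Complexity Theory* (CUP 1995), §9.2.
-/

namespace Literature.Computability.MetaComplexity

open _root_.Computability Complexity Complexity.PropForm Netlist Cluster FregeSystem

namespace ModMulU

namespace Comm

variable (L : ℕ)

/-! ### The pieces -/

/-- Length of a shift chain. [folklore] -/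
def OT (L : ℕ) : ℕ := L * (4 * L + 2)
/-- Length of a distributivity kit. [folklore] -/
def LDL (L : ℕ) : ℕ := LD.o4 L + 2 * L * LD.MF L + (6 * L + 2)
/-- Offset of `M_0`. [folklore] -/
def oM (L : ℕ) : ℕ := (6 * L + 2) + 2 * OT L
/-- Offset of `LD1_0`. [folklore] -/
def oL (L : ℕ) : ℕ := oM L + (L + 1) * LD.RT L

/-- Reference to bit `j` of `B = b >> k` (kit inputs `a, b, n, z`). [folklore] -/
def Bref (k j : ℕ) : ℕ ⊕ ℕ := if j + k < L then Sum.inl (L + (j + k)) else Sum.inl (3 * L)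

/-- Wiring of `M_s = a ⊗ B_s`. [folklore] -/
def wM (s : ℕ) (i : ℕ) : ℕ ⊕ ℕ := if i < L then Sum.inl i else if i < 2 * L then Bref L (L - s) (i - L) else Sum.inl i
/-- Wiring of `LD1_s = LD(B_s, B_s, a)`. [folklore] -/
def wL1 (s : ℕ) (i : ℕ) : ℕ ⊕ ℕ :=
  if i < L then Bref L (L - s) i else if i < 2 * L then Bref L (L - s) (i - L)
  else if i < 3 * L then Sum.inl (i - 2 * L) else Sum.inl (i - L)
/-- Wiring of `LD2_s = LD(R(MS(LD1_s)), u_s, a)`. [folklore] -/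
def wL2 (s : ℕ) (i : ℕ) : ℕ ⊕ ℕ :=
  if i < L then Sum.inr (oL L + 2 * s * LDL L + (5 * L + 2) + i)
  else if i < 2 * L then (if i = L then Sum.inl (L + (L - 1 - s)) else Sum.inl (3 * L))
  else if i < 3 * L then Sum.inl (i - 2 * L) else Sum.inl (i - L)

/-- The pieces. [cite: Vollmer1999, §1.2] -/
def pieces (L : ℕ) (k : ℕ) : Piece :=
  if k = 0 then ⟨Sub.subT L, 2 * L, fun i => if i < L then Sum.inl i else Sum.inl (L + i)⟩
  else if k = 1 then ⟨Sub.subT L, 2 * L, fun i => Sum.inl (L + i)⟩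
  else if k = 2 then ⟨One.oneT L, 2 * L + 1, fun i => if i < 2 * L then Sum.inl (L + i) else Sum.inl (3 * L)⟩
  else if k = 3 then ⟨One.oneT L, 2 * L + 1, fun i => if i < L then Sum.inl i else if i < 2 * L then Sum.inl (L + i) else Sum.inl (3 * L)⟩
  else if k ≤ 4 + L then ⟨mulRT L, 3 * L, wM L (k - 4)⟩
  else if k ≤ 4 + 3 * L then
    (if (k - 5 - L) % 2 = 0 then ⟨LD.ldT L, 4 * L, wL1 L ((k - 5 - L) / 2)⟩ else ⟨LD.ldT L, 4 * L, wL2 L ((k - 5 - L) / 2)⟩)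
  else ⟨mulRT L, 3 * L, fun i => if i < L then Sum.inl (L + i) else if i < 2 * L then Sum.inl (i - L) else Sum.inl i⟩

/-- Closed-form offsets. [folklore] -/
def offF (L : ℕ) (k : ℕ) : ℕ :=
  if k = 0 then 0 else if k = 1 then 3 * L + 1 else if k = 2 then 6 * L + 2 else if k = 3 then 6 * L + 2 + OT L
  else if k ≤ 5 + L then oM L + (k - 4) * LD.RT L
  else if k ≤ 5 + 3 * L then oL L + (k - 5 - L) * LDL L else oL L + 2 * L * LDL L + LD.RT L

/-- **The commutativity kit.** [cite: Vollmer1999, §1.2–1.3] -/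
def commT (L : ℕ) : Template := layout (pieces L) (6 + 3 * L)

/-- Lengths. [folklore] -/
theorem length_oneT : (One.oneT L).length = OT L := by
  rw [One.oneT, length_layout, One.offset_pieces]; rfl

/-- Lengths. [folklore] -/
theorem length_ldT' : (LD.ldT L).length = LDL L := LD.length_ldT L

/-- The length of piece `k`. [folklore] -/
theorem length_piece (k : ℕ) : (pieces L k).T.length =
    if k ≤ 1 then 3 * L + 1 else if k ≤ 3 then OT L else if k ≤ 4 + L then LD.RT L else if k ≤ 4 + 3 * L then LDL L else LD.RT L := by
  unfold pieces
  by_cases h0 : k = 0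
  · subst h0; simp
  by_cases h1 : k = 1
  · subst h1; simp
  by_cases h2 : k = 2
  · subst h2; simp [length_oneT]
  by_cases h3 : k = 3
  · subst h3; simp [length_oneT]
  rw [if_neg h0, if_neg h1, if_neg h2, if_neg h3, if_neg (show ¬k ≤ 1 by omega), if_neg (show ¬k ≤ 3 by omega)]
  by_cases h4 : k ≤ 4 + L
  · rw [if_pos h4, if_pos h4]; simp [LD.RT, ML]
  rw [if_neg h4, if_neg h4]
  by_cases h5 : k ≤ 4 + 3 * L
  · rw [if_pos h5, if_pos h5]
    by_cases h6 : (k - 5 - L) % 2 = 0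
    · rw [if_pos h6]; exact length_ldT' L
    · rw [if_neg h6]; exact length_ldT' L
  · rw [if_neg h5, if_neg h5]; simp [LD.RT, ML]

/-- The closed form steps like the lengths. [folklore] -/
theorem offF_succ (hL : 0 < L) (k : ℕ) (hk : k < 6 + 3 * L) : offF L (k + 1) = offF L k + (pieces L k).T.length := by
  rw [length_piece]
  rcases Nat.lt_or_ge k 4 with h | h
  · have : k = 0 ∨ k = 1 ∨ k = 2 ∨ k = 3 := by omega
    rcases this with rfl | rfl | rfl | rfl
    · simp [offF]
    · simp [offF]; ring
    · simp [offF]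
    · simp [offF, oM, OT, show 4 ≤ 5 + L from by omega]; ring
  have e0 : ¬(k = 0) := by omega
  have e1 : ¬(k = 1) := by omega
  have e2 : ¬(k = 2) := by omega
  have e3 : ¬(k = 3) := by omega
  have f0 : ¬(k + 1 = 0) := by omega
  have f1 : ¬(k + 1 = 1) := by omega
  have f2 : ¬(k + 1 = 2) := by omega
  have f3 : ¬(k + 1 = 3) := by omega
  have g1 : ¬(k ≤ 1) := by omega
  have g3 : ¬(k ≤ 3) := by omega
  by_cases h4 : k ≤ 4 + L
  · have h5 : k ≤ 5 + L := by omega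
    have h5' : k + 1 ≤ 5 + L := by omega
    simp only [offF, e0, e1, e2, e3, f0, f1, f2, f3, g1, g3, h4, h5, h5', if_false, if_true]
    rw [show k + 1 - 4 = k - 4 + 1 by omega]; ring
  by_cases h6 : k ≤ 4 + 3 * L
  · have h7 : k + 1 ≤ 5 + 3 * L := by omega
    have h7' : ¬(k + 1 ≤ 5 + L) := by omega
    rcases Nat.lt_or_ge k (5 + L + 1) with h8 | h8
    · have hk' : k = 5 + L := by omega
      subst hk'
      have h9 : 5 + L ≤ 5 + L := le_rfl
      simp only [offF, e0, e1, e2, e3, f0, f1, f2, f3, g1, g3, h4, h6, h7, h7', h9, if_false, if_true]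
      rw [show 5 + L - 4 = L + 1 by omega, show 5 + L + 1 - 5 - L = 1 by omega]; unfold oL; ring
    · have h9 : ¬(k ≤ 5 + L) := by omega
      have h10 : k ≤ 5 + 3 * L := by omega
      simp only [offF, e0, e1, e2, e3, f0, f1, f2, f3, g1, g3, h4, h6, h7, h7', h9, h10, if_false, if_true]
      rw [show k + 1 - 5 - L = k - 5 - L + 1 by omega]; ring
  · have hk' : k = 5 + 3 * L := by omega
    subst hk'
    have h9 : ¬(5 + 3 * L ≤ 5 + L) := by omega
    have h10 : 5 + 3 * L ≤ 5 + 3 * L := le_rfl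
    have h11 : ¬(5 + 3 * L + 1 ≤ 5 + L) := by omega
    have h12 : ¬(5 + 3 * L + 1 ≤ 5 + 3 * L) := by omega
    simp only [offF, e0, e1, e2, e3, f0, f1, f2, f3, g1, g3, h4, h6, h9, h10, h11, h12, if_false, if_true]
    have e : 5 + 3 * L - 5 - L = 2 * L := by omega
    rw [e]

/-- **The offsets of the pieces are the closed forms.** [folklore] -/
theorem offset_pieces (hL : 0 < L) : ∀ k ≤ 6 + 3 * L, offset (pieces L) k = offF L k := by
  intro k hk
  induction k with
  | zero => rfl
  | succ k ih => rw [offset_succ, ih (by omega), offF_succ L hL k (by omega)]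

/-- Length of the kit. [folklore] -/
theorem length_commT (hL : 0 < L) : (commT L).length = oL L + 2 * L * LDL L + LD.RT L := by
  rw [commT, length_layout, offset_pieces L hL _ le_rfl]; unfold offF
  rw [if_neg (show ¬6 + 3 * L = 0 by omega), if_neg (show ¬6 + 3 * L = 1 by omega), if_neg (show ¬6 + 3 * L = 2 by omega),
    if_neg (show ¬6 + 3 * L = 3 by omega), if_neg (show ¬6 + 3 * L ≤ 5 + L by omega), if_neg (show ¬6 + 3 * L ≤ 5 + 3 * L by omega)]

/-- A reference to a bit of `B`. [folklore] -/
theorem Bref_ok (k j : ℕ) {off : ℕ} : (∀ a, Bref L k j = Sum.inl a → a < 3 * L + 1) ∧ (∀ g, Bref L k j = Sum.inr g → g < off) := by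
  unfold Bref; split_ifs <;> exact ⟨fun a ha => (by cases ha; omega), fun g hg => by cases hg⟩

/-- The wiring of `M_s` is input-only and in range. [folklore] -/
theorem wM_ok (s i O : ℕ) (hi : i < 3 * L) :
    (∀ a, wM L s i = Sum.inl a → a < 3 * L + 1) ∧ (∀ g, wM L s i = Sum.inr g → g < O) := by
  unfold wM
  split_ifs
  · exact ⟨fun a ha => (by cases ha; omega), fun g hg => by cases hg⟩
  · exact Bref_ok L _ _
  · exact ⟨fun a ha => (by cases ha; omega), fun g hg => by cases hg⟩

/-- The wiring of `LD1_s` is input-only and in range. [folklore] -/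
theorem wL1_ok (s i O : ℕ) (hi : i < 4 * L) :
    (∀ a, wL1 L s i = Sum.inl a → a < 3 * L + 1) ∧ (∀ g, wL1 L s i = Sum.inr g → g < O) := by
  unfold wL1
  split_ifs
  · exact Bref_ok L _ _
  · exact Bref_ok L _ _
  · exact ⟨fun a ha => (by cases ha; omega), fun g hg => by cases hg⟩
  · exact ⟨fun a ha => (by cases ha; omega), fun g hg => by cases hg⟩

/-- The wiring of `LD2_s` is in range (its gate references point into `LD1_s`). [folklore] -/
theorem wL2_ok (s i : ℕ) (hi : i < 4 * L) (hLDL : 5 * L + 2 + L ≤ LDL L) :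
    (∀ a, wL2 L s i = Sum.inl a → a < 3 * L + 1) ∧ (∀ g, wL2 L s i = Sum.inr g → g < oL L + (2 * s + 1) * LDL L) := by
  unfold wL2
  split_ifs
  · exact ⟨fun a ha => (by cases ha), fun g hg => by cases hg; nlinarith [hLDL]⟩
  · exact ⟨fun a ha => (by cases ha; omega), fun g hg => by cases hg⟩
  · exact ⟨fun a ha => (by cases ha; omega), fun g hg => by cases hg⟩
  · exact ⟨fun a ha => (by cases ha; omega), fun g hg => by cases hg⟩
  · exact ⟨fun a ha => (by cases ha; omega), fun g hg => by cases hg⟩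

/-- Every piece is well formed and well wired (`3L + 1` inputs). [cite: Vollmer1999, Def. 1.6] -/
theorem piece_ok (hL : 0 < L) : ∀ k < 6 + 3 * L, Piece.OK (pieces L) (3 * L + 1) k := by
  intro k hk
  have hLDL : 5 * L + 2 + L ≤ LDL L := by unfold LDL LD.o4; nlinarith [Nat.zero_le (LD.RT L), Nat.zero_le (LD.MF L)]
  unfold Piece.OK
  rw [offset_pieces L hL k (by omega)]
  unfold pieces
  rcases Nat.lt_or_ge k 4 with h | h
  · have : k = 0 ∨ k = 1 ∨ k = 2 ∨ k = 3 := by omega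
    rcases this with rfl | rfl | rfl | rfl
    · simp only [if_true]
      exact ⟨Sub.wf_subT L, fun i hi => by split_ifs <;> exact ⟨fun a ha => (by cases ha; omega), fun g hg => by cases hg⟩⟩
    · simp only [show (1 : ℕ) ≠ 0 from by decide, if_false, if_true]
      exact ⟨Sub.wf_subT L, fun i hi => ⟨fun a ha => (by cases ha; omega), fun g hg => by cases hg⟩⟩
    · simp only [show (2 : ℕ) ≠ 0 from by decide, show (2 : ℕ) ≠ 1 from by decide, if_false, if_true]
      exact ⟨One.wf_oneT L, fun i hi => by split_ifs <;> exact ⟨fun a ha => (by cases ha; omega), fun g hg => by cases hg⟩⟩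
    · simp only [show (3 : ℕ) ≠ 0 from by decide, show (3 : ℕ) ≠ 1 from by decide, show (3 : ℕ) ≠ 2 from by decide, if_false, if_true]
      exact ⟨One.wf_oneT L, fun i hi => by split_ifs <;> exact ⟨fun a ha => (by cases ha; omega), fun g hg => by cases hg⟩⟩
  · rw [if_neg (show ¬k = 0 by omega), if_neg (show ¬k = 1 by omega), if_neg (show ¬k = 2 by omega), if_neg (show ¬k = 3 by omega)]
    by_cases h4 : k ≤ 4 + L
    · rw [if_pos h4]
      exact ⟨wf_mulRT L, fun i hi => wM_ok L _ _ _ hi⟩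
    rw [if_neg h4]
    by_cases h5 : k ≤ 4 + 3 * L
    · rw [if_pos h5]
      by_cases hpar : (k - 5 - L) % 2 = 0
      · rw [if_pos hpar]
        exact ⟨LD.wf_ldT L, fun i hi => wL1_ok L _ _ _ hi⟩
      · rw [if_neg hpar]
        refine ⟨LD.wf_ldT L, fun i hi => ⟨(wL2_ok L _ _ hi hLDL).1, fun g hg => ((wL2_ok L _ _ hi hLDL).2 g hg).trans_le ?_⟩⟩
        unfold offF
        rw [if_neg (show ¬k = 0 by omega), if_neg (show ¬k = 1 by omega), if_neg (show ¬k = 2 by omega), if_neg (show ¬k = 3 by omega),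
          if_neg (show ¬k ≤ 5 + L by omega), if_pos (show k ≤ 5 + 3 * L by omega)]
        have : 2 * ((k - 5 - L) / 2) + 1 = k - 5 - L := by omega
        rw [this]
    · rw [if_neg h5]
      exact ⟨wf_mulRT L, fun i hi => by dsimp only at hi ⊢; split_ifs <;> exact ⟨fun a ha => (by cases ha; omega), fun g hg => by cases hg⟩⟩

/-- **The commutativity kit is well formed** (`3L + 1` inputs). [cite: Vollmer1999, Def. 1.6] -/
theorem wf_commT (hL : 0 < L) : (commT L).WF (3 * L + 1) := wf_layout (pieces L) (piece_ok L hL)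

/-! ### Unfolding the pieces -/

/-- Pieces `0 … 3`. [folklore] -/
theorem pieces_0123 :
    pieces L 0 = ⟨Sub.subT L, 2 * L, fun i => if i < L then Sum.inl i else Sum.inl (L + i)⟩ ∧
    pieces L 1 = ⟨Sub.subT L, 2 * L, fun i => Sum.inl (L + i)⟩ ∧
    pieces L 2 = ⟨One.oneT L, 2 * L + 1, fun i => if i < 2 * L then Sum.inl (L + i) else Sum.inl (3 * L)⟩ ∧
    pieces L 3 = ⟨One.oneT L, 2 * L + 1, fun i => if i < L then Sum.inl i else if i < 2 * L then Sum.inl (L + i) else Sum.inl (3 * L)⟩ :=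
  ⟨rfl, rfl, rfl, rfl⟩

/-- Piece `4 + s` is `M_s`. [folklore] -/
theorem pieces_M {s : ℕ} (hs : s ≤ L) : pieces L (4 + s) = ⟨mulRT L, 3 * L, wM L s⟩ := by
  unfold pieces
  rw [if_neg (show ¬4 + s = 0 by omega), if_neg (show ¬4 + s = 1 by omega), if_neg (show ¬4 + s = 2 by omega),
    if_neg (show ¬4 + s = 3 by omega), if_pos (show 4 + s ≤ 4 + L by omega), show 4 + s - 4 = s by omega]

/-- Piece `5 + L + 2s` is `LD1_s`. [folklore] -/
theorem pieces_LD1 {s : ℕ} (hs : s < L) : pieces L (5 + L + 2 * s) = ⟨LD.ldT L, 4 * L, wL1 L s⟩ := by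
  unfold pieces
  rw [if_neg (show ¬5 + L + 2 * s = 0 by omega), if_neg (show ¬5 + L + 2 * s = 1 by omega), if_neg (show ¬5 + L + 2 * s = 2 by omega),
    if_neg (show ¬5 + L + 2 * s = 3 by omega), if_neg (show ¬5 + L + 2 * s ≤ 4 + L by omega),
    if_pos (show 5 + L + 2 * s ≤ 4 + 3 * L by omega), if_pos (show (5 + L + 2 * s - 5 - L) % 2 = 0 by omega),
    show (5 + L + 2 * s - 5 - L) / 2 = s by omega]

/-- Piece `6 + L + 2s` is `LD2_s`. [folklore] -/
theorem pieces_LD2 {s : ℕ} (hs : s < L) : pieces L (6 + L + 2 * s) = ⟨LD.ldT L, 4 * L, wL2 L s⟩ := by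
  unfold pieces
  rw [if_neg (show ¬6 + L + 2 * s = 0 by omega), if_neg (show ¬6 + L + 2 * s = 1 by omega), if_neg (show ¬6 + L + 2 * s = 2 by omega),
    if_neg (show ¬6 + L + 2 * s = 3 by omega), if_neg (show ¬6 + L + 2 * s ≤ 4 + L by omega),
    if_pos (show 6 + L + 2 * s ≤ 4 + 3 * L by omega), if_neg (show ¬(6 + L + 2 * s - 5 - L) % 2 = 0 by omega),
    show (6 + L + 2 * s - 5 - L) / 2 = s by omega]

/-- Piece `5 + 3L` is `BA`. [folklore] -/
theorem pieces_BA : pieces L (5 + 3 * L) =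
    ⟨mulRT L, 3 * L, fun i => if i < L then Sum.inl (L + i) else if i < 2 * L then Sum.inl (i - L) else Sum.inl i⟩ := by
  unfold pieces
  rw [if_neg (show ¬5 + 3 * L = 0 by omega), if_neg (show ¬5 + 3 * L = 1 by omega), if_neg (show ¬5 + 3 * L = 2 by omega),
    if_neg (show ¬5 + 3 * L = 3 by omega), if_neg (show ¬5 + 3 * L ≤ 4 + L by omega), if_neg (show ¬5 + 3 * L ≤ 4 + 3 * L by omega)]

/-! ### The views of an occurrence -/

section Views

variable (o : Occ)

/-- Operand `a`. [folklore] -/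
def av (i : ℕ) : ℕ := o.inp i
/-- Operand `b`. [folklore] -/
def bv (i : ℕ) : ℕ := o.inp (L + i)
/-- The modulus. [folklore] -/
def nv (i : ℕ) : ℕ := o.inp (2 * L + i)
/-- The zero gate. [folklore] -/
def zv : ℕ := o.inp (3 * L)
/-- The shifted words `Bw k = b >> k` (zero gate above); `B_s = Bw (L - s)`. [folklore] -/
def Bw (k j : ℕ) : ℕ := if j + k < L then o.inp (L + (j + k)) else o.inp (3 * L)
/-- The one-hot words `u_s = (b_{L-1-s}, z, …, z)`. [folklore] -/
def uw (s i : ℕ) : ℕ := if i = 0 then o.inp (L + (L - 1 - s)) else o.inp (3 * L)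
/-- The comparator `(a, n)`. [folklore] -/
def CmpA : Sub.View := ⟨o.base, av o, nv L o⟩
/-- The comparator `(b, n)`. [folklore] -/
def CmpB : Sub.View := ⟨o.base + (3 * L + 1), bv L o, nv L o⟩
/-- The shift chain of `b`. [folklore] -/
def ShB : Occ := pieceOcc (o.inst (3 * L + 1)) (pieces L) 2
/-- The shift chain of `a`. [folklore] -/
def OneA : Occ := pieceOcc (o.inst (3 * L + 1)) (pieces L) 3
/-- `M_s = a ⊗ B_s` (certified). [folklore] -/
def M (s : ℕ) : View := ⟨o.base + (oM L + s * LD.RT L), av o, Bw L o (L - s), nv L o⟩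
/-- The occurrence of `LD1_s`. [folklore] -/
def LD1 (s : ℕ) : Occ := pieceOcc (o.inst (3 * L + 1)) (pieces L) (5 + L + 2 * s)
/-- The occurrence of `LD2_s`. [folklore] -/
def LD2 (s : ℕ) : Occ := pieceOcc (o.inst (3 * L + 1)) (pieces L) (6 + L + 2 * s)
/-- `BA = b ⊗ a` (certified). [folklore] -/
def BA : View := ⟨o.base + (oL L + 2 * L * LDL L), bv L o, av o, nv L o⟩

/-- All pieces of the commutativity kit are available. [folklore] -/
structure CAvail (K : PropForm ℕ) (Γ : Set (PropForm ℕ)) : Prop where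
  /-- `(a, n)` -/
  hA : (CmpA L o).Avail K Γ L
  /-- `(b, n)` -/
  hB : (CmpB L o).Avail K Γ L
  /-- shift chain of `b` -/
  hShB : (ShB L o).Avail (One.oneT L) (2 * L + 1) K Γ
  /-- shift chain of `a` -/
  hOneA : (OneA L o).Avail (One.oneT L) (2 * L + 1) K Γ
  /-- `M_s` -/
  hM : ∀ s ≤ L, (M L o s).RAvail L K Γ
  /-- `LD1_s` -/
  hLD1 : ∀ s < L, (LD1 L o s).Avail (LD.ldT L) (4 * L) K Γ
  /-- `LD2_s` -/
  hLD2 : ∀ s < L, (LD2 L o s).Avail (LD.ldT L) (4 * L) K Γ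
  /-- `BA` -/
  hBA : (BA L o).RAvail L K Γ

end Views

variable {L} {o : Occ} {K : PropForm ℕ} {Γ : Set (PropForm ℕ)}

/-- The base of the occurrence of piece `k`. [folklore] -/
theorem base_q (hL : 0 < L) {k : ℕ} (hk : k ≤ 6 + 3 * L) : (pieceOcc (o.inst (3 * L + 1)) (pieces L) k).base = o.base + offF L k := by
  simp [pieceOcc, offset_pieces L hL k hk]

/-- An input of a piece wired to a kit input. [folklore] -/
theorem inp_q_inl {k i j : ℕ} (hw : (pieces L k).wire i = Sum.inl j) (hj : j < 3 * L + 1) :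
    (pieceOcc (o.inst (3 * L + 1)) (pieces L) k).inp i = o.inp j := by
  rw [inp_pieceOcc, hw, Occ.ref_inl o hj]

/-- An input of a piece wired to an earlier gate. [folklore] -/
theorem inp_q_inr {k i g : ℕ} (hw : (pieces L k).wire i = Sum.inr g) :
    (pieceOcc (o.inst (3 * L + 1)) (pieces L) k).inp i = o.base + g := by
  rw [inp_pieceOcc, hw, Occ.ref_inr]; rfl

/-- A reference to `B` resolves to `Bw`. [folklore] -/
theorem ref_Bref (k j : ℕ) : (o.inst (3 * L + 1)).ref (Bref L k j) = Bw L o k j := by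
  unfold Bref Bw; split_ifs <;> exact Occ.ref_inl o (by omega)

/-- Availability of the comparators. [folklore] -/
theorem avail_Cmp (hL : 0 < L) (ho : o.Avail (commT L) (3 * L + 1) K Γ) : (CmpA L o).Avail K Γ L ∧ (CmpB L o).Avail K Γ L := by
  have h0 : (pieceOcc (o.inst (3 * L + 1)) (pieces L) 0).Avail (Sub.subT L) (2 * L) K Γ := by
    have := Inst.DefsAvail.piece ho (k := 0) (by omega) (by rw [(pieces_0123 L).1]; exact Sub.wf_subT L)
    rw [(pieces_0123 L).1] at this; exact this
  have h1 : (pieceOcc (o.inst (3 * L + 1)) (pieces L) 1).Avail (Sub.subT L) (2 * L) K Γ := by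
    have := Inst.DefsAvail.piece ho (k := 1) (by omega) (by rw [(pieces_0123 L).2.1]; exact Sub.wf_subT L)
    rw [(pieces_0123 L).2.1] at this; exact this
  constructor
  · refine Sub.View.Avail.congr (Sub.avail_viewOf h0) ?_ (fun i hi => ?_) (fun i hi => ?_)
    · show o.base = (pieceOcc (o.inst (3 * L + 1)) (pieces L) 0).base; rw [base_q hL (by omega)]; rfl
    · show o.inp i = ((pieceOcc (o.inst (3 * L + 1)) (pieces L) 0).inst (2 * L)).inputs.getD i 0
      rw [Occ.getD_inst _ (show i < 2 * L by omega), inp_q_inl (k := 0) (i := i) (j := i)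
        (by rw [(pieces_0123 L).1]; dsimp only; rw [if_pos hi]) (by omega)]
    · show o.inp (2 * L + i) = ((pieceOcc (o.inst (3 * L + 1)) (pieces L) 0).inst (2 * L)).inputs.getD (L + i) 0
      rw [Occ.getD_inst _ (show L + i < 2 * L by omega), inp_q_inl (k := 0) (i := L + i) (j := 2 * L + i)
        (by rw [(pieces_0123 L).1]; dsimp only; rw [if_neg (show ¬L + i < L by omega)]; congr 1; omega) (by omega)]
  · refine Sub.View.Avail.congr (Sub.avail_viewOf h1) ?_ (fun i hi => ?_) (fun i hi => ?_)
    · show o.base + (3 * L + 1) = (pieceOcc (o.inst (3 * L + 1)) (pieces L) 1).base; rw [base_q hL (by omega)]; rfl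
    · show o.inp (L + i) = ((pieceOcc (o.inst (3 * L + 1)) (pieces L) 1).inst (2 * L)).inputs.getD i 0
      rw [Occ.getD_inst _ (show i < 2 * L by omega), inp_q_inl (k := 1) (i := i) (j := L + i) (by rw [(pieces_0123 L).2.1]) (by omega)]
    · show o.inp (2 * L + i) = ((pieceOcc (o.inst (3 * L + 1)) (pieces L) 1).inst (2 * L)).inputs.getD (L + i) 0
      rw [Occ.getD_inst _ (show L + i < 2 * L by omega), inp_q_inl (k := 1) (i := L + i) (j := 2 * L + i)
        (by rw [(pieces_0123 L).2.1]; dsimp only; congr 1; omega) (by omega)]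

/-- Availability of the shift chains. [folklore] -/
theorem avail_chains (ho : o.Avail (commT L) (3 * L + 1) K Γ) :
    (ShB L o).Avail (One.oneT L) (2 * L + 1) K Γ ∧ (OneA L o).Avail (One.oneT L) (2 * L + 1) K Γ := by
  constructor
  · have := Inst.DefsAvail.piece ho (k := 2) (by omega) (by rw [(pieces_0123 L).2.2.1]; exact One.wf_oneT L)
    rw [(pieces_0123 L).2.2.1] at this; exact this
  · have := Inst.DefsAvail.piece ho (k := 3) (by omega) (by rw [(pieces_0123 L).2.2.2]; exact One.wf_oneT L)
    rw [(pieces_0123 L).2.2.2] at this; exact this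

/-- Availability of `M_s`. [folklore] -/
theorem avail_M (hL : 0 < L) (ho : o.Avail (commT L) (3 * L + 1) K Γ) {s : ℕ} (hs : s ≤ L) : (M L o s).RAvail L K Γ := by
  have hq : (pieceOcc (o.inst (3 * L + 1)) (pieces L) (4 + s)).Avail (mulRT L) (3 * L) K Γ := by
    have := Inst.DefsAvail.piece ho (k := 4 + s) (by omega) (by rw [pieces_M L hs]; exact wf_mulRT L)
    rw [pieces_M L hs] at this; exact this
  refine (ravail_ofOcc hq).congr ?_ (fun i hi => ?_) (fun i hi => ?_) (fun i hi => ?_)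
  · show o.base + (oM L + s * LD.RT L) = (pieceOcc (o.inst (3 * L + 1)) (pieces L) (4 + s)).base
    rw [base_q hL (by omega)]; unfold offF
    rw [if_neg (show ¬4 + s = 0 by omega), if_neg (show ¬4 + s = 1 by omega), if_neg (show ¬4 + s = 2 by omega),
      if_neg (show ¬4 + s = 3 by omega), if_pos (show 4 + s ≤ 5 + L by omega), show 4 + s - 4 = s by omega]
  · show o.inp i = (pieceOcc (o.inst (3 * L + 1)) (pieces L) (4 + s)).inp i
    rw [inp_q_inl (k := 4 + s) (i := i) (j := i) (by rw [pieces_M L hs]; dsimp only; unfold wM; rw [if_pos hi]) (by omega)]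
  · show Bw L o (L - s) i = (pieceOcc (o.inst (3 * L + 1)) (pieces L) (4 + s)).inp (L + i)
    rw [inp_pieceOcc, pieces_M L hs]; dsimp only; unfold wM
    rw [if_neg (show ¬L + i < L by omega), if_pos (show L + i < 2 * L by omega), Nat.add_sub_cancel_left, ref_Bref]
  · show o.inp (2 * L + i) = (pieceOcc (o.inst (3 * L + 1)) (pieces L) (4 + s)).inp (2 * L + i)
    have hw : (pieces L (4 + s)).wire (2 * L + i) = Sum.inl (2 * L + i) := by
      rw [pieces_M L hs]; dsimp only; unfold wM
      rw [if_neg (show ¬2 * L + i < L by omega), if_neg (show ¬2 * L + i < 2 * L by omega)]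
    rw [inp_q_inl hw (by omega)]

/-- Availability of the distributivity kits. [folklore] -/
theorem avail_LD (ho : o.Avail (commT L) (3 * L + 1) K Γ) {s : ℕ} (hs : s < L) :
    (LD1 L o s).Avail (LD.ldT L) (4 * L) K Γ ∧ (LD2 L o s).Avail (LD.ldT L) (4 * L) K Γ := by
  constructor
  · have := Inst.DefsAvail.piece ho (k := 5 + L + 2 * s) (by omega) (by rw [pieces_LD1 L hs]; exact LD.wf_ldT L)
    rw [pieces_LD1 L hs] at this; exact this
  · have := Inst.DefsAvail.piece ho (k := 6 + L + 2 * s) (by omega) (by rw [pieces_LD2 L hs]; exact LD.wf_ldT L)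
    rw [pieces_LD2 L hs] at this; exact this

/-- Availability of `BA`. [folklore] -/
theorem avail_BA (hL : 0 < L) (ho : o.Avail (commT L) (3 * L + 1) K Γ) : (BA L o).RAvail L K Γ := by
  have hq : (pieceOcc (o.inst (3 * L + 1)) (pieces L) (5 + 3 * L)).Avail (mulRT L) (3 * L) K Γ := by
    have := Inst.DefsAvail.piece ho (k := 5 + 3 * L) (by omega) (by rw [pieces_BA]; exact wf_mulRT L)
    rw [pieces_BA] at this; exact this
  refine (ravail_ofOcc hq).congr ?_ (fun i hi => ?_) (fun i hi => ?_) (fun i hi => ?_)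
  · show o.base + (oL L + 2 * L * LDL L) = (pieceOcc (o.inst (3 * L + 1)) (pieces L) (5 + 3 * L)).base
    rw [base_q hL (by omega)]; unfold offF
    rw [if_neg (show ¬5 + 3 * L = 0 by omega), if_neg (show ¬5 + 3 * L = 1 by omega), if_neg (show ¬5 + 3 * L = 2 by omega),
      if_neg (show ¬5 + 3 * L = 3 by omega), if_neg (show ¬5 + 3 * L ≤ 5 + L by omega), if_pos (show 5 + 3 * L ≤ 5 + 3 * L from le_rfl),
      show 5 + 3 * L - 5 - L = 2 * L by omega]
  · show o.inp (L + i) = (pieceOcc (o.inst (3 * L + 1)) (pieces L) (5 + 3 * L)).inp i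
    rw [inp_q_inl (k := 5 + 3 * L) (i := i) (j := L + i) (by rw [pieces_BA]; dsimp only; rw [if_pos hi]) (by omega)]
  · show o.inp i = (pieceOcc (o.inst (3 * L + 1)) (pieces L) (5 + 3 * L)).inp (L + i)
    have hw : (pieces L (5 + 3 * L)).wire (L + i) = Sum.inl i := by
      rw [pieces_BA]; dsimp only
      rw [if_neg (show ¬L + i < L by omega), if_pos (show L + i < 2 * L by omega), Nat.add_sub_cancel_left]
    rw [inp_q_inl hw (by omega)]
  · show o.inp (2 * L + i) = (pieceOcc (o.inst (3 * L + 1)) (pieces L) (5 + 3 * L)).inp (2 * L + i)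
    have hw : (pieces L (5 + 3 * L)).wire (2 * L + i) = Sum.inl (2 * L + i) := by
      rw [pieces_BA]; dsimp only
      rw [if_neg (show ¬2 * L + i < L by omega), if_neg (show ¬2 * L + i < 2 * L by omega)]
    rw [inp_q_inl hw (by omega)]

/-- **All pieces of an available occurrence of the commutativity kit are available.** [folklore] -/
theorem avail_ofOcc (hL : 0 < L) (ho : o.Avail (commT L) (3 * L + 1) K Γ) : CAvail L o K Γ :=
  ⟨(avail_Cmp hL ho).1, (avail_Cmp hL ho).2, (avail_chains ho).1, (avail_chains ho).2, fun _ hs => avail_M hL ho hs,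
    fun _ hs => (avail_LD ho hs).1, fun _ hs => (avail_LD ho hs).2, avail_BA hL ho⟩

/-! ### The inputs of the pieces -/

/-- The inputs of the shift chain of `b`: `(b, n, z)`. [folklore] -/
theorem ShB_inp {i : ℕ} (_hi : i < 2 * L + 1) : (ShB L o).inp i = if i < 2 * L then o.inp (L + i) else o.inp (3 * L) := by
  rw [show ShB L o = pieceOcc (o.inst (3 * L + 1)) (pieces L) 2 from rfl, inp_pieceOcc, (pieces_0123 L).2.2.1]; dsimp only
  split_ifs <;> exact Occ.ref_inl o (by omega)

/-- The inputs of the shift chain of `a`: `(a, n, z)`. [folklore] -/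
theorem OneA_inp {i : ℕ} (hi : i < 2 * L + 1) :
    (OneA L o).inp i = if i < L then o.inp i else if i < 2 * L then o.inp (L + i) else o.inp (3 * L) := by
  rw [show OneA L o = pieceOcc (o.inst (3 * L + 1)) (pieces L) 3 from rfl, inp_pieceOcc, (pieces_0123 L).2.2.2]; dsimp only
  split_ifs <;> exact Occ.ref_inl o (by omega)

/-- The inputs of `LD1_s`: `(B_s, B_s, a, n)`. [folklore] -/
theorem LD1_inp {s i : ℕ} (hs : s < L) (hi : i < L) :
    (LD1 L o s).inp i = Bw L o (L - s) i ∧ (LD1 L o s).inp (L + i) = Bw L o (L - s) i ∧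
      (LD1 L o s).inp (2 * L + i) = o.inp i ∧ (LD1 L o s).inp (3 * L + i) = o.inp (2 * L + i) := by
  have e : LD1 L o s = pieceOcc (o.inst (3 * L + 1)) (pieces L) (5 + L + 2 * s) := rfl
  refine ⟨?_, ?_, ?_, ?_⟩
  · rw [e, inp_pieceOcc, pieces_LD1 L hs]; dsimp only; unfold wL1; rw [if_pos hi, ref_Bref]
  · rw [e, inp_pieceOcc, pieces_LD1 L hs]; dsimp only; unfold wL1
    rw [if_neg (show ¬L + i < L by omega), if_pos (show L + i < 2 * L by omega), Nat.add_sub_cancel_left, ref_Bref]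
  · have hw : (pieces L (5 + L + 2 * s)).wire (2 * L + i) = Sum.inl i := by
      rw [pieces_LD1 L hs]; dsimp only; unfold wL1
      rw [if_neg (show ¬2 * L + i < L by omega), if_neg (show ¬2 * L + i < 2 * L by omega), if_pos (show 2 * L + i < 3 * L by omega)]
      congr 1; omega
    rw [e, inp_q_inl hw (by omega)]
  · have hw : (pieces L (5 + L + 2 * s)).wire (3 * L + i) = Sum.inl (2 * L + i) := by
      rw [pieces_LD1 L hs]; dsimp only; unfold wL1
      rw [if_neg (show ¬3 * L + i < L by omega), if_neg (show ¬3 * L + i < 2 * L by omega), if_neg (show ¬3 * L + i < 3 * L by omega)]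
      congr 1; omega
    rw [e, inp_q_inl hw (by omega)]

/-- The inputs of `LD2_s`: `(R(MS(LD1_s)), u_s, a, n)`. [folklore] -/
theorem LD2_inp (hL : 0 < L) {s i : ℕ} (hs : s < L) (hi : i < L) :
    (LD2 L o s).inp i = (LD.MS L (LD1 L o s)).R L i ∧ (LD2 L o s).inp (L + i) = uw L o s i ∧
      (LD2 L o s).inp (2 * L + i) = o.inp i ∧ (LD2 L o s).inp (3 * L + i) = o.inp (2 * L + i) := by
  have e : LD2 L o s = pieceOcc (o.inst (3 * L + 1)) (pieces L) (6 + L + 2 * s) := rfl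
  refine ⟨?_, ?_, ?_, ?_⟩
  · have hw : (pieces L (6 + L + 2 * s)).wire i = Sum.inr (oL L + 2 * s * LDL L + (5 * L + 2) + i) := by
      rw [pieces_LD2 L hs]; dsimp only; unfold wL2; rw [if_pos hi]
    rw [e, inp_q_inr hw]
    show _ = (LD1 L o s).base + (5 * L + 2) + i
    rw [show LD1 L o s = pieceOcc (o.inst (3 * L + 1)) (pieces L) (5 + L + 2 * s) from rfl, base_q hL (by omega)]; unfold offF
    rw [if_neg (show ¬5 + L + 2 * s = 0 by omega), if_neg (show ¬5 + L + 2 * s = 1 by omega), if_neg (show ¬5 + L + 2 * s = 2 by omega),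
      if_neg (show ¬5 + L + 2 * s = 3 by omega)]
    by_cases h0 : s = 0
    · subst h0; rw [if_pos (show 5 + L + 2 * 0 ≤ 5 + L by omega), show 5 + L + 2 * 0 - 4 = L + 1 by omega]; unfold oL; ring
    · rw [if_neg (show ¬5 + L + 2 * s ≤ 5 + L by omega), if_pos (show 5 + L + 2 * s ≤ 5 + 3 * L by omega),
        show 5 + L + 2 * s - 5 - L = 2 * s by omega]; ring
  · rw [e, inp_pieceOcc, pieces_LD2 L hs]; dsimp only; unfold wL2 uw
    rw [if_neg (show ¬L + i < L by omega), if_pos (show L + i < 2 * L by omega)]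
    by_cases h0 : i = 0
    · subst h0; rw [if_pos (show L + 0 = L from rfl), if_pos rfl]; exact Occ.ref_inl o (by omega)
    · rw [if_neg (show ¬L + i = L by omega), if_neg h0]; exact Occ.ref_inl o (by omega)
  · have hw : (pieces L (6 + L + 2 * s)).wire (2 * L + i) = Sum.inl i := by
      rw [pieces_LD2 L hs]; dsimp only; unfold wL2
      rw [if_neg (show ¬2 * L + i < L by omega), if_neg (show ¬2 * L + i < 2 * L by omega), if_pos (show 2 * L + i < 3 * L by omega)]
      congr 1; omega
    rw [e, inp_q_inl hw (by omega)]
  · have hw : (pieces L (6 + L + 2 * s)).wire (3 * L + i) = Sum.inl (2 * L + i) := by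
      rw [pieces_LD2 L hs]; dsimp only; unfold wL2
      rw [if_neg (show ¬3 * L + i < L by omega), if_neg (show ¬3 * L + i < 2 * L by omega), if_neg (show ¬3 * L + i < 3 * L by omega)]
      congr 1; omega
    rw [e, inp_q_inl hw (by omega)]

end Comm

end ModMulU

end Literature.Computability.MetaComplexity
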